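import Literature.MathematicalPhysics.QuantumFieldTheory.Balaban1983to89.B9Eq3124HZKnitPairReg335Y
import Literature.MathematicalPhysics.QuantumFieldTheory.Balaban1983to89.Node00.OpsYQOnto

/-!
# `Balaban1983to89.B9Eq3115KnitLetterYFarFace` — T. Bałaban, *Propagators for lattice gauge theories in a background field*, Commun. Math. Phys. **99** (1985)
# 389–434 [Balaban1985BackgroundPropagators] (3.12)–(3.15) p. 393, p. 420 («A = GQ*(QGQ*)⁻¹B»); T. Bałaban, *Propagators and renormalization transformations for
# lattice gauge theories. II*, Commun. Math. Phys. **96** (1984) 223–250 [Balaban1984PropagatorsII] (2.3)–(2.6) p. 224, p. 228 («QGQ* is positive also and an inverse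
# is a well-defined and positive operator»); [3] (1.18): ★★ PRINT's AVERAGING `QknitY U` IS EXACTLY LEVEL-TRIANGULAR ON THE FAR-FACE ROWS at every background
# — a far-face bond of an index bond `ι` is a box bond of NO other index bond of level `≤ j(ι)` — so `Q(U)` is ONTO as soon as its DIAGONAL blocks are injective
# (law (L6) of node00-def-Y's `QLawsY`, reduced to the one-cube estimate of the sequel `B9Eq3115KnitLetterYOnto`)

statement-level skeleton of published theorems with citation tags; proofs where landed; nothing here is a claim about the
Yang–Mills mass gap

PDFs held: `paper:balaban1985-cmp99-background-propagators` (p. 420 read this seat from the text layer), `paper:balaban1984-cmp96-propagators-rt-ii` (through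
`B6SectADomainsV1` ∕ `B6SectAOntoV1`).

CITATION HEADER (lean-in-tree rule).  Cell `pub-ymgap`, seat `pub-ymgap-dag-n06-l` (gen 35; K1⁹ `stmt-QuantumFields-27364` SUPPORTS lane), programme P-Q15 file 6 =
law (L6) «`Q(U)` onto» of director-ym №375 (Q4), part 1 (the exact part).  REUSED BY NAME: files 1–3, 5 (`QknitY ∕ zSrc ∕ linCovIterC_congr ∕ linCovIterC_apply_zero ∕
proj_eq_transl_zero`), def-Y's far-face rows and their exact algebra at `U = 1` (`Node00.OpsYQOnto`: `liftIter j δ_ι`, `qK_liftRow_diag ∕ qK_liftRow_off`,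
`QY_surjective`), r03's support theorem `B6SectAOntoV1.liftIter_support`, p21's domains `B6SectADomainsV1.Domains.LamBond ∕ Deep`, the chart
`B6GlobalChartV1.domT ∕ iterBlockOf_mem_domT_iff ∕ blk_toBox ∕ boxEquiv`, t2s-1's `B9B8KnitBondAvgDictionary.transl_boxVec_mem_iterBlock`, g34's `ends_of_inBox`.

THE PRINT ∕ THE ARGUMENT.  [B9] p. 420 inverts `QGQ*` without comment; [B6] p. 228: *«QGQ* is positive also and an inverse is a well-defined and positive
operator»* = `Q` ONTO + `G > 0`.  For the flat ∕ main-term letter, ONTO is [3] (1.18)'s far-face lift: the fine bonds crossing the far `κ`-face of `B^j(ι₋)` are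
read by the index bond `ι` and by NO OTHER index bond of level `≤ j` (def-Y's `qK_liftRow_off`, r03's cross-level vanishing (2.3)–(2.6)).  THIS FILE shows the same
for PRINT's composite average `Q_j(U)` at EVERY background, where the kernel is no longer flat but LOCAL (file 3): `(Q(U)a)(ι′)` reads `a` only on the bonds with
both end-points in the double block `B^{j′}(ι′₋) ∪ B^{j′}(ι′₊)`; a far-face bond `[p, p + e_κ]` of `ι` (`p` in the last `κ`-layer of `B^j(ι₋)`, `p + e_κ ∈ B^j(ι₊)`)
has its two end-points in DIFFERENT `j`-blocks, hence in different `j′`-blocks for `j′ ≤ j`, so a level-`j′` double block containing both is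
`{B^{j′}(ι′₋), B^{j′}(ι′₊)} = {j′-block of p, j′-block of p + e_κ}` with `κ′ = κ` (integer labels in the fundamental box — no torus wrap): for `j′ = j` this is `ι`
itself; for `j′ < j` one of `ι′∓` lies inside `B^j(ι₋)` or `B^j(ι₊)`, whichever end of `ι` belongs to `Ω_j^{(j)}` ([B6] (2.3): an index bond has an end in
`Ω_j^{(j)}`), i.e. inside `Ω_j ⊂ Ω_{j′+1}` — DEEP — so `ι′` is not an index bond (both its ends are non-deep).  Consequently, for ANY per-bond values `v` supported
on the far face of `ι`: `(Q(U)v)(ι′) = 0` for every `ι′ ≠ ι` with `j(ι′) ≤ j(ι)` — EXACTLY.  With these rows the operator `Q(U) ∘ Φ`, `Φ h := Σ_ι (far-face row of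
ι) ⊗ (h ι)` twisted by any transporters, is block-triangular for the level grading with block-DIAGONAL level blocks; if every diagonal map `Y ↦ (Q(U)(row_ι ⊗ Y))(ι)`
is injective, `Q(U) ∘ Φ` is injective (induction on levels), hence bijective (finite dimension), hence `Q(U)` is ONTO.  The diagonal is `1 + O(K(d,L)·α)` by
J-B's COLUMN theorem at the retraction of file 5 — the sequel.

WHAT IS DEFINED AND PROVED (sorry-free; one definition with body — the transported far-face row `farRowY`; no estimate).
* §1 `blk_decomp_boxVec` ∕ `iterBlockOf_transl_zero` (the torus `j`-block of `0 + y` is `0 + ⌊y/Lʲ⌋`), `blk_add_e` (one fine step moves the label by `0` or `e_κ`),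
  `blk_of_inBox_bond` (a point of the double block of `ι′` has label `z_{ι′}` or `z_{ι′} + e_{κ′}`), `shift_ne_self`.
* §2 `farRow_support` (def-Y's row `liftIter j δ_ι` lives on bonds of direction `κ`, crossing from `B^j(ι₋)` into `B^j(ι₊)` — r03's `liftIter_support`),
  ★★ `not_bondIn_of_farRow_ne_zero` (THE GEOMETRIC LEMMA above).
* §3 `farRowY i T ι Y` (the row twisted by transporters `T ι b` and carrying the value `Y`), ★★ `QknitY_apply_of_farSupport_of_ne` (for ANY `v` supported on the
  far face of `ι`: `(Q(U)v)(ι′) = 0`, `ι′ ≠ ι`, `j(ι′) ≤ j(ι)`, EVERY `U`), `QknitY_farRowY_apply_of_ne`.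
* §4 ★ `surjective_of_level_triangular` (generic finite-dimensional algebra: off-diagonal vanishing toward equal-or-lower-level rows + injective diagonal maps ⇒
  onto), ★★★ `QknitY_surjective_of_diag` (`Q(U)` is ONTO at every `U` at which each diagonal map `Y ↦ (Q(U)(farRowY T ι Y))(ι)` is injective — any transporters `T`).

HONEST SCOPE.  Exact lattice geometry and finite linear algebra; no inequality of the papers; the diagonal injectivity (an estimate on [5]'s class) is the sequel's.
Count-neutral; N06 NOT discharged; nothing continuum ∕ ℝ⁴ ∕ OS ∕ mass gap ∕ Clay — the Yang–Mills mass gap is NOT proved here.  NEW file; nothing landed is modified.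
No `sorry`, no `axiom`, no `instance`, no `notation`.  Net new unproved facts: 0.
-/

noncomputable section

open scoped BigOperators

namespace Literature.MathematicalPhysics.QuantumFieldTheory.Balaban1983to89.B9Eq3115KnitLetterYFarFace

open B7Prop1Explicit renaming Site → LSite
open B7Prop1Explicit (e e_apply boxVec)
open B7Prop1Local (InBox AgreeOn loK bondHiK add_e_apply)
open B7Prop5Flat (BondIn)
open B7Eq78Linearization (conjR conjR_apply)
open B7Prop4LinCovIterClosed (linCovIterC linCovIterC_apply_zero)
open B7Prop4LinCovIterClosedLaws (linCovIterC_congr)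
open B10Eq27TorusAxialLog (transl transl_apply transl_add_e)
open B4Reflection242 (boxDom mem_boxDom blk blk_mul)
open B4Thm110ZeroBox (blk_blk)
open B5Eq118OneStroke (iterBlockOf iterBlockOf_succ mem_iterBlock)
open B5Eq117TorusCarriers (Mk)
open B6LowerBound2153Torus (rep)
open B6GlobalChartV1 (PV boxEquiv boxEquiv_apply toBox blk_toBox domT iterBlockOf_mem_domT_iff)
open B6KLevelCensusIndexV1 (KIdx)
open B6Prop22KLevelTorusCensus (KTIdx)
open B6SectAOntoV1 (liftIter liftIter_support)
open B9B8CarrierDictionary (liftCfg liftCfg_apply)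
open B9B8KnitBondTransfer (liftBd liftBd_apply)
open B9B8KnitBondAvgDictionary (transl_boxVec_mem_iterBlock)
open B9B8AveragingJunction (boxEquiv_transl_of_mem coord_bounds_of_blk_eq)
open B9Eq3115KnitLetterY (zSrc zSrc_eq_rep transl_zero_zSrc QknitY QknitY_apply lvl_le' one_le_lvl')
open B9Eq3124HZKnitPairReg335Y (proj_eq_transl_zero)
open Node00

variable {d ℓ : ℕ} {hd : 1 ≤ d + 1} {hL : Odd (ℓ + 1) ∧ 1 < ℓ + 1} {b₀ b₁ : ℝ}

/-! ## §1 Integer labels, torus blocks, one-step moves -/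

section Labels

variable (i : KIdx d ℓ hd hL b₀ b₁)

/-- every integer point is `Lʲ·⌊y/Lʲ⌋ + r` with `r ∈ [0, Lʲ)^{d+1}`. [cite: Balaban1984PropagatorsI, (1.6) p.18, bookkeeping] -/
theorem blk_decomp_boxVec (j : ℕ) (y : LSite (d + 1)) : ∃ r : Fin (d + 1) → Fin ((ℓ + 1) ^ j),
    y = (((ℓ + 1) ^ j : ℕ) : ℤ) • blk ((ℓ + 1) ^ j) y + boxVec ((ℓ + 1) ^ j) r := by
  have hb1 : 1 ≤ (ℓ + 1) ^ j := Nat.one_le_pow _ _ (Nat.succ_pos ℓ)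
  have hbz : (0 : ℤ) < (((ℓ + 1) ^ j : ℕ) : ℤ) := by positivity
  refine ⟨fun μ => ⟨(y μ % (((ℓ + 1) ^ j : ℕ) : ℤ)).toNat, ?_⟩, ?_⟩
  · have h1 := Int.emod_nonneg (y μ) hbz.ne'
    have h2 := Int.emod_lt_of_pos (y μ) hbz
    omega
  · funext μ
    have h1 := Int.emod_nonneg (y μ) hbz.ne'
    simp only [Pi.add_apply, Pi.smul_apply, smul_eq_mul, boxVec, blk]
    rw [Int.toNat_of_nonneg h1]
    linarith [Int.mul_ediv_add_emod (y μ) (((ℓ + 1) ^ j : ℕ) : ℤ)]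

/-- ★ **THE TORUS `j`-BLOCK OF `0 + y` IS `0 + ⌊y/Lʲ⌋`** (t2s-1's `transl_boxVec_mem_iterBlock` for a general integer point).
[cite: Balaban1984PropagatorsI, (1.6) p.18, (1.18) p.20, dictionary] -/
theorem iterBlockOf_transl_zero {j : ℕ} (hj : j ≤ i.m + i.K) (y : LSite (d + 1)) :
    iterBlockOf j (transl (0 : Site (PV d ℓ i.m i.K hd hL) 0) y) = transl (0 : Site (PV d ℓ i.m i.K hd hL) j) (blk ((ℓ + 1) ^ j) y) := by
  obtain ⟨r, hr⟩ := blk_decomp_boxVec (d := d) (ℓ := ℓ) j y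
  have h := transl_boxVec_mem_iterBlock (m := i.m) (K := i.K) (hd := hd) (hL := hL) hj (blk ((ℓ + 1) ^ j) y) r
  rw [← hr] at h
  exact (mem_iterBlock _ _ _).1 h

omit i in
/-- one fine step in direction `κ` moves the `Lʲ`-label by `0` or by `e_κ`. [cite: Balaban1984PropagatorsI, (1.6) p.18, bookkeeping] -/
theorem blk_add_e (j : ℕ) (x : LSite (d + 1)) (κ : Fin (d + 1)) :
    blk ((ℓ + 1) ^ j) (x + e κ) = blk ((ℓ + 1) ^ j) x ∨ blk ((ℓ + 1) ^ j) (x + e κ) = blk ((ℓ + 1) ^ j) x + e κ := by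
  have hbz : (0 : ℤ) < (((ℓ + 1) ^ j : ℕ) : ℤ) := by positivity
  have hmono : ∀ μ, blk ((ℓ + 1) ^ j) x μ ≤ blk ((ℓ + 1) ^ j) (x + e κ) μ := fun μ =>
    Int.ediv_le_ediv hbz (by rw [Pi.add_apply, e_apply]; split_ifs <;> linarith)
  have hup : ∀ μ, blk ((ℓ + 1) ^ j) (x + e κ) μ ≤ blk ((ℓ + 1) ^ j) x μ + (if μ = κ then 1 else 0) := fun μ => by
    have hb1 : (1 : ℤ) ≤ (((ℓ + 1) ^ j : ℕ) : ℤ) := by exact_mod_cast Nat.one_le_pow _ _ (Nat.succ_pos ℓ)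
    simp only [blk, Pi.add_apply, e_apply]
    split_ifs with h
    · have h2 : (x μ + 1) / (((ℓ + 1) ^ j : ℕ) : ℤ) ≤ (x μ + (((ℓ + 1) ^ j : ℕ) : ℤ)) / (((ℓ + 1) ^ j : ℕ) : ℤ) :=
        Int.ediv_le_ediv hbz (by linarith)
      rw [Int.add_ediv_of_dvd_right (dvd_refl _), Int.ediv_self hbz.ne'] at h2
      exact h2
    · rw [add_zero, add_zero]
  by_cases h : blk ((ℓ + 1) ^ j) (x + e κ) κ = blk ((ℓ + 1) ^ j) x κ
  · left
    funext μ
    by_cases hμ : μ = κ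
    · subst hμ; exact h
    · have h1 := hmono μ; have h2 := hup μ; rw [if_neg hμ, add_zero] at h2; exact le_antisymm h2 h1
  · right
    funext μ
    by_cases hμ : μ = κ
    · subst hμ
      have h1 := hmono μ; have h2 := hup μ; rw [if_pos rfl] at h2
      rw [Pi.add_apply, e_apply, if_pos rfl]
      omega
    · have h1 := hmono μ; have h2 := hup μ; rw [if_neg hμ, add_zero] at h2
      rw [Pi.add_apply, e_apply, if_neg hμ, add_zero]
      exact le_antisymm h2 h1

/-- a point of the double block `[Lʲz, Lʲz + (Lʲ − 1)𝟙 + Lʲe_κ]` of an index bond has `Lʲ`-label `z` or `z + e_κ`. [cite: Balaban1985Averaging, p.24 («Bᵏ(c₋) ∪ Bᵏ(c₊)»), bookkeeping] -/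
theorem blk_of_inBox_bond {j : ℕ} {z x : LSite (d + 1)} {κ : Fin (d + 1)} (hx : InBox (loK (ℓ + 1) j z) (bondHiK (ℓ + 1) j z κ) x) :
    blk ((ℓ + 1) ^ j) x = z ∨ blk ((ℓ + 1) ^ j) x = z + e κ := by
  have hbz : (0 : ℤ) < (((ℓ + 1) ^ j : ℕ) : ℤ) := by positivity
  have hb : (((ℓ + 1) ^ j : ℕ) : ℤ) = (((ℓ + 1 : ℕ) : ℤ)) ^ j := by push_cast; ring
  -- coordinatewise quotient
  have hq : ∀ μ, blk ((ℓ + 1) ^ j) x μ = z μ ∨ (μ = κ ∧ blk ((ℓ + 1) ^ j) x μ = z μ + 1) := fun μ => by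
    obtain ⟨h1, h2⟩ := hx μ
    simp only [loK, bondHiK] at h1 h2
    rw [← hb] at h1 h2
    simp only [blk]
    have hlo : z μ ≤ x μ / (((ℓ + 1) ^ j : ℕ) : ℤ) := Int.le_ediv_of_mul_le hbz (by linarith)
    by_cases hμ : μ = κ
    · rw [if_pos hμ] at h2
      have hhi : x μ / (((ℓ + 1) ^ j : ℕ) : ℤ) < z μ + 2 := Int.ediv_lt_of_lt_mul hbz (by linarith)
      by_cases he : x μ / (((ℓ + 1) ^ j : ℕ) : ℤ) = z μ
      · exact Or.inl he
      · exact Or.inr ⟨hμ, by omega⟩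
    · rw [if_neg hμ] at h2
      have hhi : x μ / (((ℓ + 1) ^ j : ℕ) : ℤ) < z μ + 1 := Int.ediv_lt_of_lt_mul hbz (by linarith)
      exact Or.inl (by omega)
  by_cases hk : blk ((ℓ + 1) ^ j) x κ = z κ
  · left; funext μ
    rcases hq μ with h | ⟨hμ, h⟩
    · exact h
    · subst hμ; omega
  · right; funext μ
    rw [Pi.add_apply, e_apply]
    rcases hq μ with h | ⟨hμ, h⟩
    · by_cases hμ : μ = κ
      · subst hμ; exact absurd h hk
      · rw [if_neg hμ, add_zero]; exact h
    · subst hμ; rw [if_pos rfl]; exact h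

omit i in
/-- on a torus with at least two sites per direction a unit shift moves every site. [cite: Balaban1984PropagatorsI, (1.6) p.18, bookkeeping] -/
theorem shift_ne_self {P : Params} {j : ℕ} (hP : 2 ≤ P.sitesPerDir j) (y : Site P j) (κ : Fin P.d) : y.shift κ ≠ y := by
  intro h
  have hμ := congrFun h κ
  simp only [Site.shift, Function.update_self] at hμ
  have h1 : (1 : ZMod (P.sitesPerDir j)) = 0 := by
    have h := congrArg (fun t => t - y κ) hμ
    simp only [add_sub_cancel_left, sub_self] at h
    exact h
  have hne : NeZero (P.sitesPerDir j) := ⟨by omega⟩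
  have := (ZMod.val_eq_zero (1 : ZMod (P.sitesPerDir j))).2 h1
  rw [ZMod.val_one_eq_one_mod] at this
  have h2 : 1 % P.sitesPerDir j = 1 := Nat.mod_eq_of_lt (by omega)
  omega

end Labels

/-! ## §2 The far-face rows and THE GEOMETRIC LEMMA -/

section FarFace

variable (i : KIdx d ℓ hd hL b₀ b₁)

/-- **def-Y's FAR-FACE ROW of the index bond `ι = ⟨j, c⟩`**: r03's `j`-fold far-face lift of `δ_c` ([3] (1.18); `Node00.OpsYQOnto`'s right-inverse rows).
[cite: Balaban1984PropagatorsI, (1.18) p.20; Balaban1985BackgroundPropagators, (3.12) p.393] -/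
abbrev farRow (ι : IBondY i) : FBondY i → ℝ := liftIter (ι.1.1 : ℕ) (Pi.single ι.1.2 (1 : ℝ))

/-- ★ **SUPPORT OF THE FAR-FACE ROW** (r03's `liftIter_support`): a bond carrying the row of `ι` has the direction of `ι`, starts in `B^j(ι₋)` and ends in `B^j(ι₊)`.
[cite: Balaban1984PropagatorsI, (1.18) p.20, (1.11) p.19] -/
theorem farRow_support {ι : IBondY i} {b : FBondY i} (hb : farRow i ι b ≠ 0) :
    b.dir = ι.1.2.dir ∧ iterBlockOf (ι.1.1 : ℕ) b.src = ι.1.2.src ∧ iterBlockOf (ι.1.1 : ℕ) b.tgt = ι.1.2.tgt := by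
  have hj : (ι.1.1 : ℕ) ≤ (PV d ℓ i.m i.K hd hL).m + (PV d ℓ i.m i.K hd hL).K := (lvl_le' i ι).trans i.hk
  obtain ⟨h1, h2⟩ := liftIter_support (ι.1.1 : ℕ) hj (Pi.single ι.1.2 (1 : ℝ)) b hb
  have heq : (⟨iterBlockOf (ι.1.1 : ℕ) b.src, b.dir⟩ : PBond (PV d ℓ i.m i.K hd hL) (ι.1.1 : ℕ)) = ι.1.2 := by
    by_contra hne
    exact h1 (by rw [Pi.single_apply, if_neg hne])
  have hsrc : iterBlockOf (ι.1.1 : ℕ) b.src = ι.1.2.src := congrArg PBond.src heq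
  have hdir : b.dir = ι.1.2.dir := congrArg PBond.dir heq
  refine ⟨hdir, hsrc, ?_⟩
  rw [h2, hsrc, hdir]
  rfl

/-- two index bonds with the same level, the same source labels and the same direction are equal. [cite: Balaban1984PropagatorsII, (2.3) p.224, bookkeeping] -/
theorem ibond_ext {ι ι' : IBondY i} (hj : (ι'.1.1 : ℕ) = (ι.1.1 : ℕ)) (hs : ∀ μ, (ι'.1.2.src μ).val = (ι.1.2.src μ).val)
    (hdir : ι'.1.2.dir = ι.1.2.dir) : ι' = ι := by
  obtain ⟨⟨j', b'⟩, p'⟩ := ι'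
  obtain ⟨⟨j, b⟩, p⟩ := ι
  have hjj : j' = j := Fin.ext hj
  subst hjj
  obtain ⟨s', μ'⟩ := b'
  obtain ⟨s, μ⟩ := b
  simp only at hs hdir
  subst hdir
  have hss : s' = s := funext fun ν => ZMod.val_injective _ (hs ν)
  subst hss
  rfl

/-- ★★ **THE GEOMETRIC LEMMA**: a far-face bond of `ι` (a bond carrying def-Y's far-face row) is a BOX BOND of no other index bond `ι′` of level `≤ j(ι)` — for every
integer lift `x` of its source, `x` and `x + e_κ` are not both in the double block `[L^{j′}z_{ι′}, L^{j′}z_{ι′} + (L^{j′} − 1)𝟙 + L^{j′}e_{κ′}]`.  ([B6] (2.3): an index bond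
has an end in `Ω_j^{(j)}` and no end inside `Ω_{j+1}`; nesting of blocks.) [cite: Balaban1984PropagatorsII, (2.1)–(2.4) p.224; Balaban1984PropagatorsI, (1.18) p.20; Balaban1985Averaging, p.24] -/
theorem not_bondIn_of_farRow_ne_zero {ι ι' : IBondY i} (hne : ι' ≠ ι) (hle : (ι'.1.1 : ℕ) ≤ (ι.1.1 : ℕ)) {b : FBondY i}
    (hb : farRow i ι b ≠ 0) {x : LSite (d + 1)} (hx : transl (0 : Site (PV d ℓ i.m i.K hd hL) 0) x = b.src) :
    ¬ BondIn (loK (ℓ + 1) (ι'.1.1 : ℕ) (zSrc i ι')) (bondHiK (ℓ + 1) (ι'.1.1 : ℕ) (zSrc i ι') ι'.1.2.dir) x b.dir := by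
  rintro ⟨hx1, hx2⟩
  obtain ⟨hdir, hsrc, htgt⟩ := farRow_support i hb
  have hj : (ι.1.1 : ℕ) ≤ i.m + i.K := (lvl_le' i ι).trans i.hk
  have hj' : (ι'.1.1 : ℕ) ≤ i.m + i.K := (lvl_le' i ι').trans i.hk
  rw [hdir] at hx2
  -- integer labels at level `j′`
  have ha := blk_of_inBox_bond hx1
  have ha' := blk_of_inBox_bond hx2
  have hstep := blk_add_e (d := d) (ℓ := ℓ) (ι'.1.1 : ℕ) x ι.1.2.dir
  -- the torus blocks of the bond's end-points, at every level, through the lift `x`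
  have htgt_eq : b.tgt = transl (0 : Site (PV d ℓ i.m i.K hd hL) 0) (x + e ι.1.2.dir) := by
    rw [transl_add_e, hx, ← hdir]; rfl
  have hbs : ∀ {n : ℕ}, n ≤ i.m + i.K →
      iterBlockOf n b.src = transl (0 : Site (PV d ℓ i.m i.K hd hL) n) (blk ((ℓ + 1) ^ n) x) := fun hn => by
    rw [← hx, iterBlockOf_transl_zero i hn]
  have hbt : ∀ {n : ℕ}, n ≤ i.m + i.K →
      iterBlockOf n b.tgt = transl (0 : Site (PV d ℓ i.m i.K hd hL) n) (blk ((ℓ + 1) ^ n) (x + e ι.1.2.dir)) := fun hn => by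
    rw [htgt_eq, iterBlockOf_transl_zero i hn]
  -- the labels at level `j′` differ (else the `j`-labels agree and `ι₊ = ι₋`)
  have hdist : blk ((ℓ + 1) ^ (ι'.1.1 : ℕ)) (x + e ι.1.2.dir) ≠ blk ((ℓ + 1) ^ (ι'.1.1 : ℕ)) x := by
    intro heq
    have hjeq : blk ((ℓ + 1) ^ (ι.1.1 : ℕ)) (x + e ι.1.2.dir) = blk ((ℓ + 1) ^ (ι.1.1 : ℕ)) x := by
      have hgen : ∀ m : ℕ, blk ((ℓ + 1) ^ ((ι'.1.1 : ℕ) + m)) (x + e ι.1.2.dir) = blk ((ℓ + 1) ^ ((ι'.1.1 : ℕ) + m)) x := fun m => by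
        rw [pow_add, ← blk_blk, ← blk_blk, heq]
      have hm : (ι'.1.1 : ℕ) + ((ι.1.1 : ℕ) - (ι'.1.1 : ℕ)) = (ι.1.1 : ℕ) := by omega
      have h := hgen ((ι.1.1 : ℕ) - (ι'.1.1 : ℕ))
      rwa [hm] at h
    have h : ι.1.2.tgt = ι.1.2.src := by rw [← hsrc, ← htgt, hbs hj, hbt hj, hjeq]
    exact shift_ne_self (Nat.succ_le_of_lt ((PV d ℓ i.m i.K hd hL).one_lt_sitesPerDir (ι.1.1 : ℕ))) ι.1.2.src ι.1.2.dir h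
  rcases hstep with h | h
  · exact hdist h
  -- hence `κ = κ′` and the label of `x` is `z_{ι′}`
  have hκz : ι.1.2.dir = ι'.1.2.dir ∧ blk ((ℓ + 1) ^ (ι'.1.1 : ℕ)) x = zSrc i ι' := by
    rcases ha with ha | ha
    · rcases ha' with ha' | ha'
      · exfalso
        rw [h, ha] at ha'
        have := congrFun ha' ι.1.2.dir
        simp [e_apply] at this
      · rw [h, ha] at ha'
        have hκ := congrFun ha' ι.1.2.dir
        simp only [Pi.add_apply, e_apply, add_right_inj] at hκ
        by_cases hκκ : ι.1.2.dir = ι'.1.2.dir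
        · exact ⟨hκκ, ha⟩
        · rw [if_neg hκκ] at hκ; exact absurd hκ one_ne_zero
    · exfalso
      rcases ha' with ha' | ha'
      · rw [h, ha] at ha'
        have := congrFun ha' ι'.1.2.dir
        simp only [Pi.add_apply, e_apply] at this
        split_ifs at this <;> omega
      · rw [h, ha] at ha'
        have := congrFun ha' ι.1.2.dir
        simp [e_apply] at this
  obtain ⟨hκκ, hax⟩ := hκz
  have hι's : ι'.1.2.src = iterBlockOf (ι'.1.1 : ℕ) b.src := by rw [hbs hj', hax, transl_zero_zSrc]
  have hι't : ι'.1.2.tgt = iterBlockOf (ι'.1.1 : ℕ) b.tgt := by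
    rw [hbt hj', h, hax, transl_add_e, transl_zero_zSrc, hκκ]; rfl
  rcases Nat.lt_or_eq_of_le hle with hlt | hjj
  · -- `j′ < j`: one end of `ι′` is deep
    have hk1 : (ι.1.1 : ℕ) ≤ i.k := lvl_le' i ι
    have hlam : (ι.1.2.src ∈ (domT i.hN i.D i.hk).Om (ι.1.1 : ℕ) ∨ ι.1.2.tgt ∈ (domT i.hN i.D i.hk).Om (ι.1.1 : ℕ)) := ι.2.1
    rcases hlam with hs | ht
    · have h1 : (ι.1.1 : ℕ) ≤ i.D.lev (toBox i.hN b.src : LSite (d + 1)) :=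
        (iterBlockOf_mem_domT_iff i.hN i.D i.hk (one_le_lvl' i ι) hk1 b.src).1 (by rw [hsrc]; exact hs)
      have hdeep : (domT i.hN i.D i.hk).Deep (ι'.1.1 : ℕ) ι'.1.2.src := by
        change _ ∈ (domT i.hN i.D i.hk).Om ((ι'.1.1 : ℕ) + 1)
        rw [hι's, ← iterBlockOf_succ]
        exact (iterBlockOf_mem_domT_iff i.hN i.D i.hk (by omega) (by omega) b.src).2 (by omega)
      exact ι'.2.2.1 hdeep
    · have h1 : (ι.1.1 : ℕ) ≤ i.D.lev (toBox i.hN b.tgt : LSite (d + 1)) :=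
        (iterBlockOf_mem_domT_iff i.hN i.D i.hk (one_le_lvl' i ι) hk1 b.tgt).1 (by rw [htgt]; exact ht)
      have hdeep : (domT i.hN i.D i.hk).Deep (ι'.1.1 : ℕ) ι'.1.2.tgt := by
        change _ ∈ (domT i.hN i.D i.hk).Om ((ι'.1.1 : ℕ) + 1)
        rw [hι't, ← iterBlockOf_succ]
        exact (iterBlockOf_mem_domT_iff i.hN i.D i.hk (by omega) (by omega) b.tgt).2 (by omega)
      exact ι'.2.2.2 hdeep
  · -- `j′ = j`: then `ι′ = ι`
    apply hne
    refine ibond_ext i hjj (fun μ => ?_) hκκ.symm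
    have hP : (ι'.1.1 : ℕ) ≤ (PV d ℓ i.m i.K hd hL).m + (PV d ℓ i.m i.K hd hL).K := hj'
    have hP2 : (ι.1.1 : ℕ) ≤ (PV d ℓ i.m i.K hd hL).m + (PV d ℓ i.m i.K hd hL).K := hj
    rw [hι's, ← hsrc, B5Eq118OneStroke.val_iterBlockOf _ hP, B5Eq118OneStroke.val_iterBlockOf _ hP2, hjj]

end FarFace

/-! ## §3 Exact vanishing of the off-diagonal couplings at EVERY background -/

section Vanishing

variable {𝔸 : Type} [NormedRing 𝔸] [NormOneClass 𝔸] [NormedAlgebra ℂ 𝔸] [CompleteSpace 𝔸]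
variable (i : KIdx d ℓ hd hL b₀ b₁)

/-- ★★ **A FIELD SUPPORTED ON THE FAR FACE OF `ι` IS INVISIBLE TO EVERY OTHER INDEX BOND OF LEVEL `≤ j(ι)`**: `(Q(U)v)(ι′) = 0` for `ι′ ≠ ι`, `j(ι′) ≤ j(ι)`, at EVERY
background `U` — print's `Q_j(U)` at `ι′` reads the bond field only on the box bonds of the double block of `ι′` (file 3's locality), and by the geometric lemma the
far-face bonds of `ι` are not among them. [cite: Balaban1985BackgroundPropagators, (3.12)–(3.15) p.393; Balaban1985Averaging, p.24 (after (43)); Balaban1984PropagatorsII, (2.3) p.224] -/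
theorem QknitY_apply_of_farSupport_of_ne (U : CfgY 𝔸 i) {ι ι' : IBondY i} (hne : ι' ≠ ι) (hle : (ι'.1.1 : ℕ) ≤ (ι.1.1 : ℕ))
    {v : FBondY i → 𝔸} (hv : ∀ b, farRow i ι b = 0 → v b = 0) : QknitY i U v ι' = 0 := by
  have hL1 : 1 ≤ ℓ + 1 := Nat.succ_pos ℓ
  have hB : AgreeOn (loK (ℓ + 1) (ι'.1.1 : ℕ) (zSrc i ι')) (bondHiK (ℓ + 1) (ι'.1.1 : ℕ) (zSrc i ι') ι'.1.2.dir)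
      (liftBd i v) (0 : LSite (d + 1) → Fin (d + 1) → 𝔸) := by
    intro x μ hx hxe
    rw [liftBd_apply, Pi.zero_apply, Pi.zero_apply]
    by_contra hvx
    have hrow : farRow i ι ⟨transl (0 : Site (PV d ℓ i.m i.K hd hL) 0) x, μ⟩ ≠ 0 := fun h0 => hvx (hv _ h0)
    exact not_bondIn_of_farRow_ne_zero i hne hle hrow rfl ⟨hx, hxe⟩
  rw [QknitY_apply, linCovIterC_congr (ℓ + 1) hL1 (ι'.1.1 : ℕ) (zSrc i ι') ι'.1.2.dir (fun _ _ _ _ => rfl) hB,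
    linCovIterC_apply_zero, Pi.zero_apply, Pi.zero_apply, smul_zero]

/-- **THE TRANSPORTED FAR-FACE ROW CARRYING A VALUE**: `b ↦ (farRow ι b) · R(T ι b)⁻¹ Y` (def-Y's right-inverse row, twisted by an arbitrary transporter table and
scaled by `Y ∈ 𝔸`), `ℂ`-linear in `Y`. [cite: Balaban1984PropagatorsI, (1.18) p.20; Balaban1985BackgroundPropagators, (3.12) p.393] -/
def farRowY (T : IBondY i → FBondY i → 𝔸ˣ) (ι : IBondY i) : 𝔸 →ₗ[ℂ] (FBondY i → 𝔸) where
  toFun Y := fun b => ((farRow i ι b : ℝ) : ℂ) • conjR (T ι b)⁻¹ Y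
  map_add' Y Y' := by funext b; simp only [Pi.add_apply, B7Eq78Linearization.conjR_add, smul_add]
  map_smul' c Y := by funext b; simp only [Pi.smul_apply, RingHom.id_apply, B7Eq78Linearization.conjR_smul, smul_comm c]

omit [NormOneClass 𝔸] [CompleteSpace 𝔸] in
/-- `farRowY`, evaluated. [cite: Balaban1984PropagatorsI, (1.18) p.20, bookkeeping] -/
theorem farRowY_apply (T : IBondY i → FBondY i → 𝔸ˣ) (ι : IBondY i) (Y : 𝔸) (b : FBondY i) :
    farRowY i T ι Y b = ((farRow i ι b : ℝ) : ℂ) • conjR (T ι b)⁻¹ Y := rfl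

/-- ★★ the transported row of `ι` is invisible to every other index bond of level `≤ j(ι)`, at EVERY background and for EVERY transporter table.
[cite: Balaban1985BackgroundPropagators, (3.12)–(3.15) p.393; Balaban1984PropagatorsII, (2.3) p.224] -/
theorem QknitY_farRowY_apply_of_ne (U : CfgY 𝔸 i) (T : IBondY i → FBondY i → 𝔸ˣ) {ι ι' : IBondY i} (hne : ι' ≠ ι)
    (hle : (ι'.1.1 : ℕ) ≤ (ι.1.1 : ℕ)) (Y : 𝔸) : QknitY i U (farRowY i T ι Y) ι' = 0 :=
  QknitY_apply_of_farSupport_of_ne i U hne hle fun b hb => by rw [farRowY_apply, hb, Complex.ofReal_zero, zero_smul]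

end Vanishing

/-! ## §4 Level-triangular with injective diagonal ⇒ onto -/

section Algebra

variable {𝔸 : Type} [NormedRing 𝔸] [NormedAlgebra ℂ 𝔸] [FiniteDimensional ℂ 𝔸]
variable {X Y : Type} [Fintype Y]

/-- ★ **LEVEL-TRIANGULAR WITH INJECTIVE DIAGONAL ⇒ ONTO** (finite linear algebra): if a linear `Q : (X → 𝔸) → (Y → 𝔸)` has rows `r_y : 𝔸 →ₗ (X → 𝔸)` invisible to every
OTHER index `y′` of level `≤ lv y` (`(Q (r_y a))(y′) = 0`) and every diagonal map `a ↦ (Q (r_y a))(y)` is injective, then `Q` is onto: `Q ∘ (h ↦ Σ_y r_y (h y))` is an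
injective (induction on levels), hence bijective, endomorphism of the finite-dimensional space `Y → 𝔸`. [cite: Balaban1984PropagatorsII, p.228 («QGQ* is positive also and an inverse is a well-defined and positive operator»); Balaban1985BackgroundPropagators, p.420] -/
theorem surjective_of_level_triangular (lv : Y → ℕ) (Q : (X → 𝔸) →ₗ[ℂ] (Y → 𝔸)) (r : Y → 𝔸 →ₗ[ℂ] (X → 𝔸))
    (hoff : ∀ y y', y' ≠ y → lv y' ≤ lv y → ∀ a, Q (r y a) y' = 0)
    (hdiag : ∀ y, Function.Injective fun a => Q (r y a) y) : Function.Surjective Q := by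
  classical
  -- the lift `Φ h = Σ_y r_y (h y)` and the endomorphism `M = Q ∘ Φ`
  let Φ : (Y → 𝔸) →ₗ[ℂ] (X → 𝔸) := ∑ y : Y, (r y) ∘ₗ (LinearMap.proj y)
  have hΦ : ∀ h : Y → 𝔸, Φ h = ∑ y : Y, r y (h y) := fun h => by
    simp only [Φ, LinearMap.coe_sum, Finset.sum_apply, LinearMap.comp_apply, LinearMap.proj_apply]
  let M : (Y → 𝔸) →ₗ[ℂ] (Y → 𝔸) := Q ∘ₗ Φ
  have hM : ∀ (h : Y → 𝔸) (y' : Y), M h y' = ∑ y : Y, Q (r y (h y)) y' := fun h y' => by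
    simp only [M, LinearMap.comp_apply, hΦ, map_sum, Finset.sum_apply]
  -- injective: the levels are peeled off from the bottom
  have hinj : Function.Injective M := by
    rw [← LinearMap.ker_eq_bot, LinearMap.ker_eq_bot']
    intro h hMh
    have key : ∀ n : ℕ, ∀ y, lv y < n → h y = 0 := by
      intro n
      induction n with
      | zero => intro y hy; omega
      | succ n ih =>
        intro y' hy'
        rcases Nat.lt_or_eq_of_le (Nat.lt_succ_iff.mp hy') with hlt | heq
        · exact ih y' hlt
        · have h0 : M h y' = 0 := by rw [hMh]; rfl
          rw [hM, Finset.sum_eq_single y'] at h0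
          · -- the diagonal term alone survives, so `h y′ = 0`
            have h00 : (fun a => Q (r y' a) y') (h y') = (fun a => Q (r y' a) y') 0 := by
              show Q (r y' (h y')) y' = Q (r y' 0) y'
              rw [map_zero, map_zero, Pi.zero_apply]; exact h0
            exact hdiag y' h00
          · intro y _ hyy
            by_cases hle : lv y' ≤ lv y
            · exact hoff y y' (Ne.symm hyy) hle (h y)
            · have : h y = 0 := ih y (by omega)
              rw [this, map_zero, map_zero, Pi.zero_apply]
          · intro hy; exact absurd (Finset.mem_univ y') hy
    funext y
    obtain ⟨n, hn⟩ : ∃ n, lv y < n := ⟨lv y + 1, Nat.lt_succ_self _⟩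
    exact key n y hn
  have hsurj : Function.Surjective M := LinearMap.surjective_of_injective hinj
  intro g
  obtain ⟨h, hh⟩ := hsurj g
  exact ⟨Φ h, hh⟩

end Algebra

/-! ## §5 `Q(U)` is onto as soon as its diagonal blocks are injective -/

section Onto

variable {𝔸 : Type} [NormedRing 𝔸] [NormOneClass 𝔸] [NormedAlgebra ℂ 𝔸] [CompleteSpace 𝔸] [FiniteDimensional ℂ 𝔸]
variable (i : KIdx d ℓ hd hL b₀ b₁)

/-- ★★★ **PRINT's AVERAGING IS ONTO AT EVERY BACKGROUND AT WHICH ITS DIAGONAL BLOCKS ARE INJECTIVE**: for any transporter table `T`, if every map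
`Y ↦ (Q(U)(farRowY T ι Y))(ι)` is injective, then `Q(U) = QknitY i U` is surjective (§3 + §4).  The diagonal is `1 + O(K(d,L)·α)` on [5]'s class (sequel).
[cite: Balaban1985BackgroundPropagators, p.420 («ω = (QGQ*)⁻¹B»), (3.12)–(3.15) p.393; Balaban1984PropagatorsII, p.228; Balaban1984PropagatorsI, (1.18) p.20] -/
theorem QknitY_surjective_of_diag (U : CfgY 𝔸 i) (T : IBondY i → FBondY i → 𝔸ˣ)
    (hdiag : ∀ ι : IBondY i, Function.Injective fun Y : 𝔸 => QknitY i U (farRowY i T ι Y) ι) : Function.Surjective (QknitY i U) := by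
  classical
  exact surjective_of_level_triangular (fun ι : IBondY i => (ι.1.1 : ℕ)) (QknitY i U) (farRowY i T)
    (fun ι ι' hne hle Y => QknitY_farRowY_apply_of_ne i U T hne hle Y) hdiag

end Onto

end Literature.MathematicalPhysics.QuantumFieldTheory.Balaban1983to89.B9Eq3115KnitLetterYFarFace

end
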